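import Summits.Ventures.Crystal3D.Theorems.StickyWulffConstantNoReconstructionGainDozenCellRadius
import Summits.Ventures.Crystal3D.Bulk.CapX2BoxW0625
import HarnessLib

/-!
# K1 flux line: every twelve-coordinated ball's Voronoi cell lies in the open ball of radius `4/5` (computational grade)

HONEST FRAMING. Venture `Summits/Ventures/Crystal3D` (cell `crystal3d-full`), route
`route-Ventures-StickyWulffConstant`, crux `NoReconstructionGain` (stmt-Ventures-19144), line
replication-exactness, K1 «Voronoi flux calibration» (memo `HOME/wulff-p1/g22/VFLUX2-g22.md` §3).
Discharges the hypothesis `NoHole t` of `…NoReconstructionGainDozenCellRadius` at `t = 0.625` with the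
tree's CERTIFIED cap census `CapX2.noHole_0625 : NoHole 0.625` (seat typer-bulk; 67 interval checks by
`native_decide`, each the evaluation of a checker whose soundness is a kernel theorem): radius
`1/(2 · 0.625) = 4/5`.  Reading for the flux line: a flux calibration truncated at any `r₀ ≥ 4/5` has NO
free boundary at a twelve-coordinated ball (its whole Voronoi cell is inside the truncation ball), hence is
exact there (`12 − deg = 0`, `V = 0`); at `r₀ = 1/√2` it is not (a kissing dozen can leave a `46.55°` hole).
The printed Böröczky–Szabó bound (Acta Math. Hungar. 146 (2015), Cor. 2(ii): empty caps have angular radius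
`< 50.9796°`) would give `0.7942`; the numerical hole maximum `46.553°` suggests `0.7272`.

GRADE: COMPUTATIONAL — standard axioms + `Lean.ofReduceBool` through `CapX2.noHole_0625` (no
`native_decide` is run in THIS file).  WHAT THIS IS NOT: nothing about areas/fluxes is typed; no claim on
the crux; F-C1 not moved.
-/

noncomputable section

open scoped InnerProductSpace RealInnerProductSpace

namespace Summit.Ventures.Crystal3D.Theorems

open Summit.Ventures.Crystal3D

/-- **Kissing-dozen cell radius `4/5`** (computational grade): for twelve unit vectors with pairwise inner
products `≤ 1/2`, every `p` with `⟪p, w_k⟫ ≤ 1/2` for all `k` has `‖p‖ < 4/5`.  From `CapX2.noHole_0625`. -/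
theorem norm_lt_four_fifths_of_dozenCell {w : Fin 12 → EuclideanSpace ℝ (Fin 3)} (hw : ∀ k, ‖w k‖ = 1)
    (hww : ∀ k l, k ≠ l → ⟪w k, w l⟫_ℝ ≤ 1 / 2) {p : EuclideanSpace ℝ (Fin 3)} (hp : ∀ k, ⟪p, w k⟫_ℝ ≤ 1 / 2) :
    ‖p‖ < 4 / 5 := by
  have h := norm_lt_of_noHole CapX2.noHole_0625 (by norm_num) hw hww hp
  have h45 : (1 : ℝ) / (2 * 0.625) = 4 / 5 := by norm_num
  rwa [h45] at h

/-- **Packing form, radius `4/5`** (computational grade): in a unit packing, every point of the Voronoi cell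
of a twelve-coordinated ball relative to its twelve contact neighbours lies within distance `< 4/5` of the
ball's centre — the degree-twelve exactness radius of the K1 flux calibration.  From `CapX2.noHole_0625`. -/
theorem dozenCell_dist_lt_four_fifths {N : ℕ} {x : Fin N → EuclideanSpace ℝ (Fin 3)} (hx : IsUnitPacking x) {i : Fin N}
    {e : Fin 12 → Fin N} (he : Function.Injective e) (hcontact : ∀ k, dist (x (e k)) (x i) = 1)
    {p : EuclideanSpace ℝ (Fin 3)} (hp : ∀ k, dist p (x i) ≤ dist p (x (e k))) : dist p (x i) < 4 / 5 := by
  have h := dozenCell_dist_lt_of_noHole CapX2.noHole_0625 (by norm_num) hx he hcontact hp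
  have h45 : (1 : ℝ) / (2 * 0.625) = 4 / 5 := by norm_num
  rwa [h45] at h

end Summit.Ventures.Crystal3D.Theorems

end
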